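import Summits.CriticalPhenomena.PercolationContinuityZ3.Theorems.PercNearOneGluingNoHeavyConstsMDLXJoint
import Summits.CriticalPhenomena.PercolationContinuityZ3.Theorems.PercNearOneGluingNoHeavyLowerTailCSHDefs
import Literature.Probability.Percolation.ConditionalPositiveAssociationProofs
import Literature.Probability.LatticeModels.ProdBernoulliWeightContinuity
import HarnessLib

/-!
# MDL(X)′ (`Consts.MDLXJoint`) is a STRENGTHENING of MDL(X): the conjecture implies the tree's level-0 hierarchy

builds on p205010 (kernel theorem, internal audit signed; external expert review pending)

PAPER-2 track "percolation constants", part (ii), seat `prim-consts-2`.  Support file (`--supports stmt-CriticalPhenomena-4575`);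
no definitions, no named facts, no sorries.

* `Consts.covD_conn_nonneg` — for `x ∉ Y` and monotone `f`, the denominator-free conditioned covariance
  `CSH.covD w x Y f u = μ(D)·∫_{D ∩ {x↔u}} f(𝐂_x) − (∫_D f(𝐂_x))·μ(D ∩ {x↔u})`, `D = {x ↮ Y}`, is `≥ 0` (van den Berg–Häggström–Kahn Thm 1.3:
  `f(𝐂_x)` and `1{u ∈ 𝐂_x}` are increasing functions of the cluster, positively correlated given `{x ↮ Y}`).
* `Consts.mdlx_of_mdlxJoint` — **`MDLXJoint ⟹ MDL(X)`** for non-degenerate weights: from `μ(𝒜∩D∩W)·cov_D(F;y) ≤ μ(𝒜∩D)·cov_D(F;z)`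
  (the conjecture), `μ(𝒜∩W)·μ(𝒜∩D) ≤ μ(𝒜)·μ(𝒜∩D∩W)` (`Consts.jointObserverConst_ge`), `cov_D(F;y) ≥ 0` and `μ(𝒜∩D) > 0`:
  `μ(𝒜∩W)·cov_D(F;y) ≤ μ(𝒜)·cov_D(F;z)`, i.e. the tree's `CovTau.markerDominanceAvoid` written with `CSH.covD`.  So the chain of this track
  reads CSH′ (`Consts.CSHObsJoint`) ⟹ MDL(X)′ (`Consts.mdlxJoint_of_cshObsJoint`) ⟹ MDL(X) (this file), non-degenerate weights throughout.

References: J. van den Berg, O. Häggström, J. Kahn, Random Struct. Alg. 29 (2006), Thm. 1.3, §2.1.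
-/

noncomputable section

namespace Summit.CriticalPhenomena.PercolationContinuityZ3.Theorems

open MeasureTheory Set Literature.Probability.LatticeModels Literature.Probability.Percolation
open scoped Classical

namespace Consts

variable {V : Type*} [Fintype V]

/-- **`cov_D(f; x ↔ u) ≥ 0`** (`CSH.covD`, `D = {x ↮ Y}`, `x ∉ Y`, `f` monotone): van den Berg–Häggström–Kahn's Theorem 1.3 for the two
increasing cluster functionals `f` and `1{u ∈ V(𝐂_x)}`. [cite: VandenbergHaggstromKahn2005, Thm. 1.3 (p. 6)] -/
theorem covD_conn_nonneg (w : Sym2 V → unitInterval) (x : V) (Y : Set V) (hx : x ∉ Y) (f : Set (Sym2 V) → ℝ) (hf : Monotone f)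
    (u : V) : 0 ≤ CSH.covD w x Y f u := by
  set μ := prodBernoulli w with hμ
  set D : Set (BondConfig V) := {ω | ∀ y ∈ Y, ¬ (openGraph ω).Reachable x y} with hD
  have key := BHK2006_clusterConditionalPositiveAssociation_holds V w x Y f (connIndicatorFn x u) hf
    (monotone_connIndicatorFn x u) hx
  -- read the connection indicator as the indicator of `{x ↔ u}`
  have h1 : ∫ ω in D, connIndicatorFn x u (openEdgeCluster ω x) ∂μ = μ.real (D ∩ openConn x u) := by
    simp_rw [connIndicatorFn_openEdgeCluster]
    exact KNPreFKG.setIntegral_indicator_one_eq μ D _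
  have h2 : ∫ ω in D, f (openEdgeCluster ω x) * connIndicatorFn x u (openEdgeCluster ω x) ∂μ =
      ∫ ω in D ∩ openConn x u, f (openEdgeCluster ω x) ∂μ := by
    simp_rw [connIndicatorFn_openEdgeCluster]
    have hfun : (fun ω : BondConfig V => f (openEdgeCluster ω x) * (openConn x u : Set (BondConfig V)).indicator 1 ω) =
        (openConn x u : Set (BondConfig V)).indicator (fun ω => f (openEdgeCluster ω x)) := by
      funext ω
      rw [← Set.indicator_mul_right (openConn x u) (fun ω => f (openEdgeCluster ω x)) (1 : BondConfig V → ℝ)]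
      simp only [Pi.one_apply, mul_one]
    rw [hfun, setIntegral_indicator (MeasurableSet.of_discrete)]
  rw [h1, h2] at key
  -- `covD = μ(D)·∫_{D∩{x↔u}} f − (∫_D f)·μ(D∩{x↔u})`
  show 0 ≤ μ.real D * (∫ ω in D ∩ openConn x u, f (openEdgeCluster ω x) ∂μ) -
      (∫ ω in D, f (openEdgeCluster ω x) ∂μ) * μ.real (D ∩ openConn x u)
  linarith

/-- **MDL(X)′ ⟹ MDL(X)** (non-degenerate weights).  If `Consts.MDLXJoint` holds then for every `n`, weights `w ∈ (0,1)` on `Fin n`, owner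
`s`, avoided set `X ∌ s`, markers `y ∉ {s} ∪ X` and `z`, and every monotone `F`:
`μ(𝒜 ∩ W) · cov_D(F; s ↔ y) ≤ μ(𝒜) · cov_D(F; s ↔ z)` (`𝒜 = {y ↮ {s}∪X}`, `W = {y ↔ z}`) — the tree's MDL(X) in `CSH.covD` form.
[cite: VandenbergHaggstromKahn2005, Thm. 1.4 (p. 7), §2.1 (pp. 9–13)] -/
theorem mdlx_of_mdlxJoint (h : MDLXJoint) {n : ℕ} (w : Sym2 (Fin n) → unitInterval) (hw : ∀ e, 0 < w e ∧ w e < 1)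
    (s y z : Fin n) (X : Set (Fin n)) (hsX : s ∉ X) (hy : y ∉ insert s X) (F : Set (Sym2 (Fin n)) → ℝ) (hF : Monotone F) :
    (prodBernoulli w).real ({ω : BondConfig (Fin n) | ∀ x ∈ insert s X, ¬ (openGraph ω).Reachable y x} ∩ openConn y z) *
        CSH.covD w s X F y ≤
      (prodBernoulli w).real {ω : BondConfig (Fin n) | ∀ x ∈ insert s X, ¬ (openGraph ω).Reachable y x} * CSH.covD w s X F z := by
  have hsy : s ≠ y := fun h' => hy (h' ▸ mem_insert s X)
  set μ := prodBernoulli w with hμ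
  set 𝒜 : Set (BondConfig (Fin n)) := {ω | ∀ x ∈ insert s X, ¬ (openGraph ω).Reachable y x} with h𝒜
  set D : Set (BondConfig (Fin n)) := {ω | ∀ x ∈ X, ¬ (openGraph ω).Reachable s x} with hD
  set W : Set (BondConfig (Fin n)) := openConn y z with hW
  -- the conjecture at this datum, in `CSH.covD` form
  have hJ : μ.real (𝒜 ∩ D ∩ W) * CSH.covD w s X F y ≤ μ.real (𝒜 ∩ D) * CSH.covD w s X F z := h n w s y z X hsy F hF
  -- `p ≤ p'`
  have hpp : μ.real (𝒜 ∩ W) * μ.real (𝒜 ∩ D) ≤ μ.real 𝒜 * μ.real (𝒜 ∩ D ∩ W) := jointObserverConst_ge w s y z X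
  -- signs
  have hcY : 0 ≤ CSH.covD w s X F y := covD_conn_nonneg w s X hsX F hF y
  have h𝒜0 : 0 ≤ μ.real 𝒜 := measureReal_nonneg
  have hpos : 0 < μ.real (𝒜 ∩ D) := by
    refine prodBernoulli_real_pos_of_nonempty hw ⟨∅, ?_, ?_⟩
    · intro a ha hreach
      have hbot : openGraph (∅ : BondConfig (Fin n)) = ⊥ := by
        unfold openGraph; exact SimpleGraph.fromEdgeSet_empty
      rw [hbot, SimpleGraph.reachable_bot] at hreach
      exact hy (hreach ▸ ha)
    · intro a ha hreach
      have hbot : openGraph (∅ : BondConfig (Fin n)) = ⊥ := by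
        unfold openGraph; exact SimpleGraph.fromEdgeSet_empty
      rw [hbot, SimpleGraph.reachable_bot] at hreach
      exact hsX (hreach ▸ ha)
  -- chain: μ(𝒜W)·cY·μ(𝒜D) ≤ μ(𝒜)·μ(𝒜DW)·cY ≤ μ(𝒜)·μ(𝒜D)·cZ, then divide by μ(𝒜D) > 0
  have h1 : μ.real (𝒜 ∩ W) * CSH.covD w s X F y * μ.real (𝒜 ∩ D) ≤ μ.real 𝒜 * (μ.real (𝒜 ∩ D ∩ W) * CSH.covD w s X F y) := by
    have := mul_le_mul_of_nonneg_right hpp hcY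
    linarith [this]
  have h2 : μ.real 𝒜 * (μ.real (𝒜 ∩ D ∩ W) * CSH.covD w s X F y) ≤ μ.real 𝒜 * (μ.real (𝒜 ∩ D) * CSH.covD w s X F z) :=
    mul_le_mul_of_nonneg_left hJ h𝒜0
  have h3 : (μ.real (𝒜 ∩ W) * CSH.covD w s X F y) * μ.real (𝒜 ∩ D) ≤ (μ.real 𝒜 * CSH.covD w s X F z) * μ.real (𝒜 ∩ D) := by
    have := h1.trans h2
    linarith [this]
  exact le_of_mul_le_mul_right h3 hpos

end Consts

end Summit.CriticalPhenomena.PercolationContinuityZ3.Theorems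

end
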